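import Summits.QuantumFields.BalabanUV.Beta.D1BFx.DshWordTadpole
import Summits.QuantumFields.BalabanUV.Beta.D1BFx.ColumnGaugeDefectRecord
import Summits.QuantumFields.BalabanUV.Beta.D1BFx.PackedStraightColumn
import Summits.QuantumFields.BalabanUV.Beta.BubbleParity

/-!
# `BalabanUV.Beta.D1BFx.ChartDefectRowsDshMass` — road «BF-x», binder row D1, PART 24-hyb HEAD (OWNER d1-p2 g25 `ChartDefectHead` v1.1: `hAdd`∕`hBdd` resp. the `Decay510` door;
# SPEC v1.2 §4; N-g25-1): **THE HEAD's ROW (dd) `z₀ ↦ ½·tadpole G ([Λc e z₀, [Λc a 0, Dsh n]])` IN MASS CURRENCY AGAINST ANY PACKED LEG WHOSE OFF-DIAGONAL BLOCKS ARE BOUNDED —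
# `Decay510 (…) (½·S·2·(Cλe^{κ′∕2})²·(e^{2κ′}+1)²·(4·(2·(n^{3+1}·((3+1)·n))))·Zl 4 (κ′∕8)) (κ′∕8)`: NET `n⁵ × S`, every cofactor CLOSED and n-free; AND THE STRAIGHT-LEG COUNT AS A
# THEOREM: against `K₀ = KInvStep 3 n 0` (`S = (n⁵)⁻¹·C₄e^{κ₁₆₃(4)∕4}`) the constant has NO power of `n` left; AT THE HEAD's OWN (ROAD) PIN, UNSPLIT: EXACTLY ONE power of `n`**
# (FILE 3 of 3; FILE 1 = `DshWordMass`, FILE 2 = `DshWordTadpole`)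

HONEST DEPENDENCY (cell records, verbatim): «continuum YM on T⁴ ⇐ BetaPertH ∧ nine spine estimates (0/9 proved); BetaPertH ⇐ (D1) ∧ (D4) ∧
CAP+tail; G-an2-4 gates asym, D1 and NE2/3/4.»  HONEST FRAMING (cell contract, verbatim): «discharging `BetaPertH` makes Bałaban's UV stability
UNCONDITIONAL — a real constructive-QFT result; it is NOT the continuum limit and NOT the Clay problem.»  THIS MODULE is [folklore] ∕ [our objects] bookkeeping BY NAME over
LANDED objects: FILES 1–2 `DshWordMass` ∕ `DshWordTadpole`; g32's `ColumnGaugeDefectRecord.abs_lockedWeight_record_le` (`|(n⁴∕2)·bmGaugeAt ρ_c (colH K₀ n μ y) n w| ≤ Cλ·e^{−(κ′∕(4n))|w − n•y|₁}`,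
`Cλ = 4C₄e^{κ′}`) and `ColumnGaugeDefectEnvelope.abs_weight_legSite_le`; gan24-leaf-05's «G0-COL-ENV» `PackedStraightColumn.abs_colH_K₀_road_le` (straight, `(n⁵)⁻¹`) and `PackedColumnEnvelope.abs_colH_G₀_road_le` (dressed, `(n⁴)⁻¹`); an2's
`BubbleParity.trK_KInvStep ∕ trK_coDressKBmAt_KInvStep` (sign symmetry); lit `DecimatedMomentSummable.absMoment₂_of_decay510`, `B12Sec2to5.secondMoment_abs_le_of_decay510`.
The LEG letters (`|G x (n•Y) (inl α) (inr m)| ≤ S`, `|G (n•X) y (inr m) (inl α)| ≤ S`, resp. `trK G = sgnK G` + `|colH G n μ Y κ u| ≤ S`) are DISPLAYED hypotheses on an ARBITRARY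
packed kernel `G` in §4; §6–§7 DISCHARGE them for the straight and the road leg with the tree's column envelopes — the road constant then carries ONE power of `n` (the dressed
column's face-sheet power `n⁻⁴` against the unsplit `Dsh` mass `n⁵`, F-g23-1), which is DISPLAYED, not argued away.  No `def`, no `def … : Prop`, nothing cited, NO printed hypothesis, 0 sorry.  An INTERMEDIATE per-word letter (an2
R-D1-g45-4 (3)): it prices ONE displayed row of the HEAD modulo the leg letters, NOT the HEAD; 0∕4 row-D1 binders (hW ∕ hR ∕ D1Tel ∕ D1Rep); (K) NOT closed; (J1) ONE OPEN ROW;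
NOT D1, NEVER «G-an2-4 closed», NOT `BetaPertH`, NOT continuum, NOT Clay.

ABSOLUTE RULE (cell charter, verbatim): «No internally-minted statement may enter as a cited fact. Every hypothesis is either kernel-proved in
this package or a verbatim quotation of a PUBLISHED theorem with page reference. The manuscript(s) under audit are NOT citable for their own
disputed steps — they are the thing under adjudication; programme-internal (2001/route/tribunal) claims are never citable.»

WHY.  O-8 (`ChartDefectRowsDsh`, sup currency) gives the (dd) constant `≍ n⁸·C_A` — not n-uniform.  Here `|tadpole G W| ≤ S·mass(W)` with `S` the sup of the leg's fm∕mf blocks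
ON THE WORD's SUPPORT (FILE 1 §0) and `mass(W z₀) ≤ c·n⁵·e^{−(κ′∕8)|z₀|₁}` (FILE 1 §2 at the record's weights) — NET `n⁵ × S`; against the STRAIGHT kernel (`ℋ`-columns `≤ (n⁵)⁻¹·C₄e^{κ₁₆₃(4)∕4}`,
g53∕g60) the constant is `n`-FREE (the g32 memo's count as a theorem).  At the ROAD leg the dressed columns' sup decides between O(1) (bulk `n⁻⁵`) and the O-6′ face-split
refinement (F-g23-1 sheets `n⁻⁴` × `DshFaceMass` one power lower) — NOT decided here.

CONTENT (`K₀ := KInvStep 3 n 0`, `ρ_c := ctr 4 n`, `Λc μ y := diagK (z b ↦ (n⁴∕2)·bmGaugeAt ρ_c (colH K₀ n μ y) n (legSite ρ_c z b))`, `κ′ := kappa163 (3+1)∕((3:ℝ)+1)`,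
`Cλ := 4·(MG163 (3+1)·periodConst (kappa163 (3+1)) 3)·e^{κ′}`, `T := 4·(2·(n^{3+1}·((3+1)·n)))`).
* §4 `abs_lockedWeight_legSite_le`; **`decay510_row_dd_mass`** (the HEAD's (dd) word LITERALLY, any leg, two column letters); **`row_dd_mass`** (sign-symmetric leg + one column
  letter: the binder shapes `AbsMoment₂` ∧ `|secondMoment| ≤ C_dd·Σ'|x|₁²e^{−(κ′∕8)|x|₁}`).
* §6 `abs_colH_K₀_le_const`, **`decay510_row_dd_mass_straight`** (constant `32·C₄′·(Cλe^{κ′∕2})²·(e^{2κ′}+1)²·Zl 4 (κ′∕8)` — n-FREE).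
* §7 `abs_colH_G₀_le_const`, **`decay510_row_dd_mass_road`** (the HEAD's own leg: constant `32·n·C_G′·(Cλe^{κ′∕2})²·(e^{2κ′}+1)²·Zl 4 (κ′∕8)` — ONE power of `n`), **`row_dd_mass_road`**
  (the HEAD's `hAdd` ∕ `hBdd` shapes at its own pin, hypothesis-free).
NOT HERE (honest): the face-split variant (O-6′ `DshFaceMass` × an interior∕face column envelope — the located way from `n¹` to O(1)); rows (xb) (bb) in mass currency (their
block words also read the leg's ff and mm blocks — next file).  Unit `b2b-balaban-beta-d1-formalise-leaf-01` (gen 33), road «BF-x»; OFFER O-9 part 3.  Not in print; our bookkeeping.  No existing file touched.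
-/

noncomputable section

namespace Summit.QuantumFields.BalabanUV.Beta.D1BFx.ChartDefectRowsDshMass

open Finset
open scoped BigOperators
open Literature.MathematicalPhysics.QuantumFieldTheory
open Literature.MathematicalPhysics.QuantumFieldTheory.LatticeForm (quo)
open Literature.MathematicalPhysics.QuantumFieldTheory.Balaban1983to89
open Literature.MathematicalPhysics.QuantumFieldTheory.Balaban1983to89.Beta
open B12Sec2to5 (l1 l1_nonneg Decay510 secondMoment_abs_le_of_decay510)
open DecimatedMomentSummable (AbsMoment₂ absMoment₂_of_decay510)
open ExpKernelCalculus (MKer Zl comp tr tadpole decay510_mono_const)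
open OneStepResolventKernel (Fib eq_zsmul_quo_of_proj)
open OneStepKernelFamily (colH KInvStep)
open AffineAveraging (Site)
open AveragingContoursRooted (ctr ctrOff ctrOff_mem_box)
open Summit.QuantumFields.BalabanUV.Beta.BorderedHessian (diagK sgnK sgnK_apply sgnF_inl sgnF_inr)
open Summit.QuantumFields.BalabanUV.Beta.TameKernelCalculus (trK trK_apply)
open Summit.QuantumFields.BalabanUV.Beta.BubbleParity (trK_KInvStep trK_coDressKBmAt_KInvStep)
open Summit.QuantumFields.BalabanUV.Beta.AxialDressingRooted (coDressKBmAt)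
open Summit.QuantumFields.BalabanUV.Beta.DshAn1 (Dsh)
open Summit.QuantumFields.BalabanUV.Beta.AxialProjectorBlockMean (bmGaugeAt)
open Summit.QuantumFields.BalabanUV.Beta.AveragingWardRootedStencils (legSite)
open Summit.QuantumFields.BalabanUV.Beta.D1BFx.ColumnGaugeDefectEnvelope (commCommDefect_apply abs_weight_legSite_le)
open Summit.QuantumFields.BalabanUV.Beta.D1BFx.ColumnGaugeDefectRecord (l1_ctr_le abs_lockedWeight_record_le)
open Summit.QuantumFields.BalabanUV.Beta.D1BFx.PackedStraightColumn (abs_colH_K₀_road_le)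
open Summit.QuantumFields.BalabanUV.Beta.D1BFx.PackedColumnEnvelope (abs_colH_G₀_road_le)
open Summit.QuantumFields.BalabanUV.Beta.D1BFx.DshWordMass
open Summit.QuantumFields.BalabanUV.Beta.D1BFx.DshWordTadpole
open B5Hk163Strip (kappa163 kappa163_pos)
open B5Hk163Decay (MG163)
open B4TorusKernel (periodConst)

/-! ## §4 The record: the HEAD's row (dd) `z₀ ↦ ½·tadpole G ([Λc e z₀, [Λc a 0, Dsh n]])` in MASS currency -/

section Record

variable {n : ℕ} [NeZero n]

/-- [folklore] The record's locked weight read at a leg site: `|(n⁴∕2)·bmGaugeAt ρ_c (colH K₀ n μ y) n (legSite ρ_c x b)| ≤ (Cλ·e^{κ′∕2})·e^{−(κ′∕(4n))|x − n•y|₁}`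
(`ColumnGaugeDefectRecord.abs_lockedWeight_record_le` + `ColumnGaugeDefectEnvelope.abs_weight_legSite_le` + `|ρ_c|₁ ≤ 2n`). -/
theorem abs_lockedWeight_legSite_le (μ : Fin (3 + 1)) (y x : Site (3 + 1)) (b : Fib 3) :
    |(n : ℝ) ^ 4 / 2 * bmGaugeAt (ctr 4 n) (colH (KInvStep (d := 3) n 0) n μ y) n (legSite (ctr 4 n) x b)|
      ≤ ((4 * (MG163 (3 + 1) * periodConst (kappa163 (3 + 1)) 3) * Real.exp (kappa163 (3 + 1) / ((3 : ℝ) + 1))) * Real.exp (kappa163 (3 + 1) / ((3 : ℝ) + 1) / 2)) * Real.exp (-(kappa163 (3 + 1) / ((3 : ℝ) + 1) / (((3 : ℝ) + 1) * n)) * l1 (x - (n : ℤ) • y)) := by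
  have hn : 1 ≤ n := Nat.one_le_iff_ne_zero.2 (NeZero.ne n)
  have hn0 : (0 : ℝ) < n := by exact_mod_cast hn
  have hC : 0 ≤ (4 * (MG163 (3 + 1) * periodConst (kappa163 (3 + 1)) 3) * Real.exp (kappa163 (3 + 1) / ((3 : ℝ) + 1))) := by
    have h := abs_lockedWeight_record_le (n := n) hn μ y ((n : ℤ) • y)
    rw [sub_self, show l1 (0 : Site (3 + 1)) = 0 by simp [B12Sec2to5.l1], mul_zero, Real.exp_zero, mul_one] at h
    exact (abs_nonneg _).trans h
  have hδ : 0 ≤ kappa163 (3 + 1) / ((3 : ℝ) + 1) / (((3 : ℝ) + 1) * n) := by have := kappa163_pos (3 + 1); positivity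
  have h := abs_weight_legSite_le (χ := fun w => (n : ℝ) ^ 4 / 2 * bmGaugeAt (ctr 4 n) (colH (KInvStep (d := 3) n 0) n μ y) n w) hC hδ (fun w => abs_lockedWeight_record_le (n := n) hn μ y w) (ctr 4 n) x b
  refine h.trans (mul_le_mul_of_nonneg_right (mul_le_mul_of_nonneg_left (Real.exp_le_exp.2 ?_) hC) (Real.exp_pos _).le)
  have h4 := l1_ctr_le 3 n
  calc kappa163 (3 + 1) / ((3 : ℝ) + 1) / (((3 : ℝ) + 1) * n) * l1 (ctr 4 n)
      ≤ kappa163 (3 + 1) / ((3 : ℝ) + 1) / (((3 : ℝ) + 1) * n) * ((((3 : ℕ) : ℝ) + 1) * n / 2) := mul_le_mul_of_nonneg_left h4 hδ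
    _ = kappa163 (3 + 1) / ((3 : ℝ) + 1) / 2 := by push_cast; field_simp

/-- **ROW (dd) OF THE HEAD IN MASS CURRENCY** [our objects + folklore]: for ANY packed leg `G : MKer 4 (Fib 3)` whose `ℋ`-type entries at the coarse points are bounded,
`|G x (n•Y) (inl α) (inr m)| ≤ S` and `|G (n•X) y (inr m) (inl α)| ≤ S` (`0 ≤ S`; the leg's ff block `Γ` and mm block never meet this word), and every `(a, e)`:
`Decay510 (z₀ ↦ ½·tadpole G ([Λc e z₀, [Λc a 0, Dsh n]])) (½·S·2·(Cλe^{κ′∕2})²·(e^{2κ′}+1)²·(4·(2·(n^{3+1}·((3+1)·n))))·Zl 4 (κ′∕8)) (κ′∕8)` with `Cλ = 4C₄e^{κ′}`,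
`κ′ = κ₁₆₃(4)∕4` — the word of the HEAD's pin `hWdd` LITERALLY.  NET COUNT DISPLAYED: `n⁵ × S`, cofactor and coarse rate `κ′∕8` n-free: O(1) exactly when the leg's `ℋ`-columns
are `O(n⁻⁵)` in sup (the STRAIGHT kernel's are: §6; the road kernel's dressed columns read `O(n⁻⁴)` unsplit: §7). -/
theorem decay510_row_dd_mass {G : MKer (3 + 1) (Fib 3)} {S : ℝ} (hS : 0 ≤ S)
    (hcolR : ∀ (x Y : Site (3 + 1)) (α m : Fin (3 + 1)), |G x ((n : ℤ) • Y) (Sum.inl α) (Sum.inr m)| ≤ S)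
    (hcolL : ∀ (X y : Site (3 + 1)) (m α : Fin (3 + 1)), |G ((n : ℤ) • X) y (Sum.inr m) (Sum.inl α)| ≤ S) (a e : Fin 4) :
    Decay510 (fun z₀ : Site 4 => (1 / 2 : ℝ) * tadpole G
        (comp (diagK fun z' b => (n : ℝ) ^ 4 / 2 * bmGaugeAt (ctr 4 n) (colH (KInvStep (d := 3) n 0) n e z₀) n (legSite (ctr 4 n) z' b))
            (comp (diagK fun z' b => (n : ℝ) ^ 4 / 2 * bmGaugeAt (ctr 4 n) (colH (KInvStep (d := 3) n 0) n a 0) n (legSite (ctr 4 n) z' b)) (Dsh n)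
              - comp (Dsh n) (diagK fun z' b => (n : ℝ) ^ 4 / 2 * bmGaugeAt (ctr 4 n) (colH (KInvStep (d := 3) n 0) n a 0) n (legSite (ctr 4 n) z' b)))
          - comp (comp (diagK fun z' b => (n : ℝ) ^ 4 / 2 * bmGaugeAt (ctr 4 n) (colH (KInvStep (d := 3) n 0) n a 0) n (legSite (ctr 4 n) z' b)) (Dsh n)
              - comp (Dsh n) (diagK fun z' b => (n : ℝ) ^ 4 / 2 * bmGaugeAt (ctr 4 n) (colH (KInvStep (d := 3) n 0) n a 0) n (legSite (ctr 4 n) z' b)))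
            (diagK fun z' b => (n : ℝ) ^ 4 / 2 * bmGaugeAt (ctr 4 n) (colH (KInvStep (d := 3) n 0) n e z₀) n (legSite (ctr 4 n) z' b))))
      ((1 / 2 : ℝ) * (S * (2 * (((4 * (MG163 (3 + 1) * periodConst (kappa163 (3 + 1)) 3) * Real.exp (kappa163 (3 + 1) / ((3 : ℝ) + 1))) * Real.exp (kappa163 (3 + 1) / ((3 : ℝ) + 1) / 2)) * ((4 * (MG163 (3 + 1) * periodConst (kappa163 (3 + 1)) 3) * Real.exp (kappa163 (3 + 1) / ((3 : ℝ) + 1))) * Real.exp (kappa163 (3 + 1) / ((3 : ℝ) + 1) / 2))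
          * (Real.exp (2 * (kappa163 (3 + 1) / ((3 : ℝ) + 1))) + 1) ^ 2 * (4 * (2 * ((n : ℝ) ^ (3 + 1) * (((3 : ℝ) + 1) * n))))
          * Zl 4 (kappa163 (3 + 1) / ((3 : ℝ) + 1) / 8)))))
      (kappa163 (3 + 1) / ((3 : ℝ) + 1) / 8) := by
  have hn0 : (0 : ℝ) < n := by exact_mod_cast Nat.pos_of_ne_zero (NeZero.ne n)
  have hκ : 0 < kappa163 (3 + 1) / ((3 : ℝ) + 1) := by have := kappa163_pos (3 + 1); positivity
  have hC : 0 ≤ (4 * (MG163 (3 + 1) * periodConst (kappa163 (3 + 1)) 3) * Real.exp (kappa163 (3 + 1) / ((3 : ℝ) + 1))) * Real.exp (kappa163 (3 + 1) / ((3 : ℝ) + 1) / 2) := by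
    have h := abs_lockedWeight_legSite_le (n := n) a 0 0 (Sum.inl 0)
    rw [smul_zero, sub_zero, show l1 (0 : Site (3 + 1)) = 0 by simp [B12Sec2to5.l1], mul_zero, Real.exp_zero, mul_one] at h
    exact (abs_nonneg _).trans h
  have hδ : 0 < kappa163 (3 + 1) / ((3 : ℝ) + 1) / (((3 : ℝ) + 1) * n) := by positivity
  have h := decay510_half_tadpole_word (n := n) hS hcolR hcolL
    (fun z' b => (n : ℝ) ^ 4 / 2 * bmGaugeAt (ctr 4 n) (colH (KInvStep (d := 3) n 0) n a 0) n (legSite (ctr 4 n) z' b))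
    (fun z₀ z' b => (n : ℝ) ^ 4 / 2 * bmGaugeAt (ctr 4 n) (colH (KInvStep (d := 3) n 0) n e z₀) n (legSite (ctr 4 n) z' b))
    hC hC hδ (fun x b => abs_lockedWeight_legSite_le (n := n) a 0 x b) (fun z₀ x b => abs_lockedWeight_legSite_le (n := n) e z₀ x b)
  have e1 : kappa163 (3 + 1) / ((3 : ℝ) + 1) / (((3 : ℝ) + 1) * n) * (((3 : ℝ) + 1) * (2 * n)) = 2 * (kappa163 (3 + 1) / ((3 : ℝ) + 1)) := by field_simp
  have e2 : kappa163 (3 + 1) / ((3 : ℝ) + 1) / (((3 : ℝ) + 1) * n) / 2 * n = kappa163 (3 + 1) / ((3 : ℝ) + 1) / 8 := by field_simp; ring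
  rwa [e1, e2] at h

/-- **ROW (dd) IN THE HEAD's BINDER SHAPES, SIGN-SYMMETRIC LEG** [our objects + folklore] (`ChartDefectHead`'s `hAdd` ∕ `hBdd`; modulo the displayed leg letters `trK G = sgnK G` and
`|colH G n μ Y κ u| ≤ S`, `0 ≤ S`): (i) `∀ a e, AbsMoment₂ (z₀ ↦ ½·tadpole G ([Λc e z₀, [Λc a 0, Dsh n]]))`; (ii) `|secondMoment (a e z₀ ↦ …) μ ν| ≤ C_dd(S, n)·Σ'_x |x|₁² e^{−(κ′∕8)|x|₁}`
(lit `absMoment₂_of_decay510`, `secondMoment_abs_le_of_decay510`).  NET `n⁵ × S`; nothing about the `n`-law of `S` is claimed here. -/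
theorem row_dd_mass {G : MKer (3 + 1) (Fib 3)} {S : ℝ} (hS : 0 ≤ S) (hsym : trK G = sgnK G)
    (hcol : ∀ (μ : Fin (3 + 1)) (Y : Site (3 + 1)) (κ : Fin (3 + 1)) (u : Site (3 + 1)), |colH G n μ Y κ u| ≤ S) (μ ν : Fin 4) :
    (∀ a e : Fin 4, AbsMoment₂ (fun z₀ : Site 4 => (1 / 2 : ℝ) * tadpole G
        (comp (diagK fun z' b => (n : ℝ) ^ 4 / 2 * bmGaugeAt (ctr 4 n) (colH (KInvStep (d := 3) n 0) n e z₀) n (legSite (ctr 4 n) z' b))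
            (comp (diagK fun z' b => (n : ℝ) ^ 4 / 2 * bmGaugeAt (ctr 4 n) (colH (KInvStep (d := 3) n 0) n a 0) n (legSite (ctr 4 n) z' b)) (Dsh n)
              - comp (Dsh n) (diagK fun z' b => (n : ℝ) ^ 4 / 2 * bmGaugeAt (ctr 4 n) (colH (KInvStep (d := 3) n 0) n a 0) n (legSite (ctr 4 n) z' b)))
          - comp (comp (diagK fun z' b => (n : ℝ) ^ 4 / 2 * bmGaugeAt (ctr 4 n) (colH (KInvStep (d := 3) n 0) n a 0) n (legSite (ctr 4 n) z' b)) (Dsh n)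
              - comp (Dsh n) (diagK fun z' b => (n : ℝ) ^ 4 / 2 * bmGaugeAt (ctr 4 n) (colH (KInvStep (d := 3) n 0) n a 0) n (legSite (ctr 4 n) z' b)))
            (diagK fun z' b => (n : ℝ) ^ 4 / 2 * bmGaugeAt (ctr 4 n) (colH (KInvStep (d := 3) n 0) n e z₀) n (legSite (ctr 4 n) z' b))))) ∧
      |B12Beta.secondMoment (fun (a e : Fin 4) (z₀ : Site 4) => (1 / 2 : ℝ) * tadpole G
        (comp (diagK fun z' b => (n : ℝ) ^ 4 / 2 * bmGaugeAt (ctr 4 n) (colH (KInvStep (d := 3) n 0) n e z₀) n (legSite (ctr 4 n) z' b))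
            (comp (diagK fun z' b => (n : ℝ) ^ 4 / 2 * bmGaugeAt (ctr 4 n) (colH (KInvStep (d := 3) n 0) n a 0) n (legSite (ctr 4 n) z' b)) (Dsh n)
              - comp (Dsh n) (diagK fun z' b => (n : ℝ) ^ 4 / 2 * bmGaugeAt (ctr 4 n) (colH (KInvStep (d := 3) n 0) n a 0) n (legSite (ctr 4 n) z' b)))
          - comp (comp (diagK fun z' b => (n : ℝ) ^ 4 / 2 * bmGaugeAt (ctr 4 n) (colH (KInvStep (d := 3) n 0) n a 0) n (legSite (ctr 4 n) z' b)) (Dsh n)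
              - comp (Dsh n) (diagK fun z' b => (n : ℝ) ^ 4 / 2 * bmGaugeAt (ctr 4 n) (colH (KInvStep (d := 3) n 0) n a 0) n (legSite (ctr 4 n) z' b)))
            (diagK fun z' b => (n : ℝ) ^ 4 / 2 * bmGaugeAt (ctr 4 n) (colH (KInvStep (d := 3) n 0) n e z₀) n (legSite (ctr 4 n) z' b)))) μ ν|
        ≤ ((1 / 2 : ℝ) * (S * (2 * (((4 * (MG163 (3 + 1) * periodConst (kappa163 (3 + 1)) 3) * Real.exp (kappa163 (3 + 1) / ((3 : ℝ) + 1))) * Real.exp (kappa163 (3 + 1) / ((3 : ℝ) + 1) / 2)) * ((4 * (MG163 (3 + 1) * periodConst (kappa163 (3 + 1)) 3) * Real.exp (kappa163 (3 + 1) / ((3 : ℝ) + 1))) * Real.exp (kappa163 (3 + 1) / ((3 : ℝ) + 1) / 2))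
          * (Real.exp (2 * (kappa163 (3 + 1) / ((3 : ℝ) + 1))) + 1) ^ 2 * (4 * (2 * ((n : ℝ) ^ (3 + 1) * (((3 : ℝ) + 1) * n))))
          * Zl 4 (kappa163 (3 + 1) / ((3 : ℝ) + 1) / 8)))))
          * ∑' x : Site 4, l1 x ^ 2 * Real.exp (-(kappa163 (3 + 1) / ((3 : ℝ) + 1) / 8) * l1 x) := by
  have hr : 0 < kappa163 (3 + 1) / ((3 : ℝ) + 1) / 8 := by have := kappa163_pos (3 + 1); positivity
  have hd := fun a e => decay510_row_dd_mass (n := n) hS (fun x Y α m => hcol m Y α x) (abs_inr_inl_le_of_sgn (n := n) hsym hcol) a e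
  refine ⟨fun a e => absMoment₂_of_decay510 hr (hd a e), ?_⟩
  exact (secondMoment_abs_le_of_decay510 (P := fun (a e : Fin 4) (z₀ : Site 4) => (1 / 2 : ℝ) * tadpole G
        (comp (diagK fun z' b => (n : ℝ) ^ 4 / 2 * bmGaugeAt (ctr 4 n) (colH (KInvStep (d := 3) n 0) n e z₀) n (legSite (ctr 4 n) z' b))
            (comp (diagK fun z' b => (n : ℝ) ^ 4 / 2 * bmGaugeAt (ctr 4 n) (colH (KInvStep (d := 3) n 0) n a 0) n (legSite (ctr 4 n) z' b)) (Dsh n)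
              - comp (Dsh n) (diagK fun z' b => (n : ℝ) ^ 4 / 2 * bmGaugeAt (ctr 4 n) (colH (KInvStep (d := 3) n 0) n a 0) n (legSite (ctr 4 n) z' b)))
          - comp (comp (diagK fun z' b => (n : ℝ) ^ 4 / 2 * bmGaugeAt (ctr 4 n) (colH (KInvStep (d := 3) n 0) n a 0) n (legSite (ctr 4 n) z' b)) (Dsh n)
              - comp (Dsh n) (diagK fun z' b => (n : ℝ) ^ 4 / 2 * bmGaugeAt (ctr 4 n) (colH (KInvStep (d := 3) n 0) n a 0) n (legSite (ctr 4 n) z' b)))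
            (diagK fun z' b => (n : ℝ) ^ 4 / 2 * bmGaugeAt (ctr 4 n) (colH (KInvStep (d := 3) n 0) n e z₀) n (legSite (ctr 4 n) z' b)))) hr (hd μ ν)).2

end Record

/-! ## §6 The STRAIGHT leg `K₀ = KInvStep 3 n 0`: `ℋ`-columns `≤ (n⁵)⁻¹·C₄e^{κ₁₆₃(4)∕4}` in sup — the same word with an `n`-FREE constant -/

section Straight

variable {n : ℕ} [NeZero n]

/-- [folklore] The straight `ℋ`-column bound without its decay factor: `|colH K₀ n μ y κ u| ≤ (n⁵)⁻¹·C₄·e^{κ₁₆₃(4)∕4}` («G0-COL-ENV» `abs_colH_K₀_road_le`, `e^{−…} ≤ 1`). -/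
theorem abs_colH_K₀_le_const (μ : Fin (3 + 1)) (y : Fin (3 + 1) → ℤ) (κ : Fin (3 + 1)) (u : Fin (3 + 1) → ℤ) :
    |colH (KInvStep (d := 3) n 0) n μ y κ u| ≤ (((n : ℝ) ^ 5)⁻¹ * ((MG163 4 * periodConst (kappa163 4) 3) * Real.exp (kappa163 4 / 4))) := by
  have hn0 : (0 : ℝ) < n := by exact_mod_cast Nat.pos_of_ne_zero (NeZero.ne n)
  have h0 := abs_colH_K₀_road_le n 0 0 0 ((n : ℤ) • (0 : Fin (3 + 1) → ℤ))
  rw [sub_self, show l1 (0 : Fin (3 + 1) → ℤ) = 0 by simp [B12Sec2to5.l1], mul_zero, Real.exp_zero, mul_one] at h0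
  refine (abs_colH_K₀_road_le n μ y κ u).trans (mul_le_of_le_one_right ((abs_nonneg _).trans h0) (Real.exp_le_one_iff.2 ?_))
  have := kappa163_pos 4
  have : 0 ≤ kappa163 4 / 4 / (4 * (n : ℝ)) * l1 (u - (n : ℤ) • y) := mul_nonneg (by positivity) (l1_nonneg _)
  linarith

/-- **THE (dd) WORD AGAINST THE STRAIGHT LEG IS A (5.10)-KERNEL WITH AN `n`-FREE CONSTANT** [our objects + folklore] (the located count «`Dsh` mass `≍ n⁵` × `ℋ`-column
`≍ n⁻⁵`» of the g32 memo, as a theorem; leg letters `trK_KInvStep` + `abs_colH_K₀_le_const`): for every `(a, e)`,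
`Decay510 (z₀ ↦ ½·tadpole K₀ ([Λc e z₀, [Λc a 0, Dsh n]])) (32·C₄′·(Cλe^{κ′∕2})²·(e^{2κ′}+1)²·Zl 4 (κ′∕8)) (κ′∕8)`, `C₄′ = C₄·e^{κ₁₆₃(4)∕4}` — NO power of `n` left.  NOT the
HEAD's row (the HEAD pins the ROAD leg `G₀ = coDressKBmAt ρ_c n K₀`, §7): the straight-leg evaluation of the same word. -/
theorem decay510_row_dd_mass_straight (a e : Fin 4) :
    Decay510 (fun z₀ : Site 4 => (1 / 2 : ℝ) * tadpole (KInvStep (d := 3) n 0)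
        (comp (diagK fun z' b => (n : ℝ) ^ 4 / 2 * bmGaugeAt (ctr 4 n) (colH (KInvStep (d := 3) n 0) n e z₀) n (legSite (ctr 4 n) z' b))
            (comp (diagK fun z' b => (n : ℝ) ^ 4 / 2 * bmGaugeAt (ctr 4 n) (colH (KInvStep (d := 3) n 0) n a 0) n (legSite (ctr 4 n) z' b)) (Dsh n)
              - comp (Dsh n) (diagK fun z' b => (n : ℝ) ^ 4 / 2 * bmGaugeAt (ctr 4 n) (colH (KInvStep (d := 3) n 0) n a 0) n (legSite (ctr 4 n) z' b)))
          - comp (comp (diagK fun z' b => (n : ℝ) ^ 4 / 2 * bmGaugeAt (ctr 4 n) (colH (KInvStep (d := 3) n 0) n a 0) n (legSite (ctr 4 n) z' b)) (Dsh n)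
              - comp (Dsh n) (diagK fun z' b => (n : ℝ) ^ 4 / 2 * bmGaugeAt (ctr 4 n) (colH (KInvStep (d := 3) n 0) n a 0) n (legSite (ctr 4 n) z' b)))
            (diagK fun z' b => (n : ℝ) ^ 4 / 2 * bmGaugeAt (ctr 4 n) (colH (KInvStep (d := 3) n 0) n e z₀) n (legSite (ctr 4 n) z' b))))
      (32 * ((MG163 4 * periodConst (kappa163 4) 3) * Real.exp (kappa163 4 / 4))
        * ((((4 * (MG163 (3 + 1) * periodConst (kappa163 (3 + 1)) 3) * Real.exp (kappa163 (3 + 1) / ((3 : ℝ) + 1))) * Real.exp (kappa163 (3 + 1) / ((3 : ℝ) + 1) / 2)) * ((4 * (MG163 (3 + 1) * periodConst (kappa163 (3 + 1)) 3) * Real.exp (kappa163 (3 + 1) / ((3 : ℝ) + 1))) * Real.exp (kappa163 (3 + 1) / ((3 : ℝ) + 1) / 2))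
          * (Real.exp (2 * (kappa163 (3 + 1) / ((3 : ℝ) + 1))) + 1) ^ 2) * Zl 4 (kappa163 (3 + 1) / ((3 : ℝ) + 1) / 8)))
      (kappa163 (3 + 1) / ((3 : ℝ) + 1) / 8) := by
  have hn0 : (n : ℝ) ≠ 0 := by exact_mod_cast NeZero.ne n
  have hC : 0 ≤ (((n : ℝ) ^ 5)⁻¹ * ((MG163 4 * periodConst (kappa163 4) 3) * Real.exp (kappa163 4 / 4))) := (abs_nonneg _).trans (abs_colH_K₀_le_const (n := n) 0 0 0 0)
  have hcol : ∀ (μ : Fin (3 + 1)) (Y : Site (3 + 1)) (κ : Fin (3 + 1)) (u : Site (3 + 1)), |colH (KInvStep (d := 3) n 0) n μ Y κ u| ≤ (((n : ℝ) ^ 5)⁻¹ * ((MG163 4 * periodConst (kappa163 4) 3) * Real.exp (kappa163 4 / 4))) :=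
    fun μ Y κ u => abs_colH_K₀_le_const (n := n) μ Y κ u
  have h := decay510_row_dd_mass (n := n) hC (fun x Y α m => hcol m Y α x) (abs_inr_inl_le_of_sgn (n := n) (trK_KInvStep n 0) hcol) a e
  refine decay510_mono_const h (le_of_eq ?_)
  field_simp
  ring

end Straight

/-! ## §7 The ROAD leg `G₀ = coDressKBmAt ρ_c n K₀` (the HEAD's pin), UNSPLIT: dressed `ℋ`-columns `≤ (n⁴)⁻¹·C_G′` in sup (F-g23-1's power) — exactly ONE power of `n` left -/

section Road

variable {n : ℕ} [NeZero n]

/-- [folklore] The dressed `ℋ`-column bound without its decay factor: `|colH G₀ n μ y κ u| ≤ (n⁴)⁻¹·C₄·(1 + 8(1 + e^{κ₁₆₃(4)∕4}))·e^{κ₁₆₃(4)∕4}` (gan24-leaf-05 g53 «G0-COL-ENV»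
`PackedColumnEnvelope.abs_colH_G₀_road_le` at the centred root, `e^{−…} ≤ 1`). -/
theorem abs_colH_G₀_le_const (μ : Fin (3 + 1)) (y : Fin (3 + 1) → ℤ) (κ : Fin (3 + 1)) (u : Fin (3 + 1) → ℤ) :
    |colH (coDressKBmAt (ctr 4 n) n (KInvStep (d := 3) n 0)) n μ y κ u| ≤ (((n : ℝ) ^ 4)⁻¹ * ((MG163 4 * periodConst (kappa163 4) 3) * (1 + 8 * (1 + Real.exp (kappa163 4 / 4))) * Real.exp (kappa163 4 / 4))) := by
  obtain ⟨m, rfl⟩ : ∃ m, n = m + 1 := Nat.exists_eq_succ_of_ne_zero (NeZero.ne n)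
  have hr := ctrOff_mem_box (d := 3 + 1) (Nat.le_add_left 1 m)
  have hn0 : (0 : ℝ) < ((m + 1 : ℕ) : ℝ) := by positivity
  have hC : 0 ≤ ((((m + 1 : ℕ) : ℝ) ^ 4)⁻¹ * ((MG163 4 * periodConst (kappa163 4) 3) * (1 + 8 * (1 + Real.exp (kappa163 4 / 4))) * Real.exp (kappa163 4 / 4))) := by
    have := kappa163_pos 4
    have hC4 : 0 ≤ MG163 4 * periodConst (kappa163 4) 3 := by
      have h0 := abs_colH_K₀_road_le (m + 1) 0 0 0 (((m + 1 : ℕ) : ℤ) • (0 : Fin (3 + 1) → ℤ))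
      rw [sub_self, show l1 (0 : Fin (3 + 1) → ℤ) = 0 by simp [B12Sec2to5.l1], mul_zero, Real.exp_zero, mul_one] at h0
      have h1 := (abs_nonneg _).trans h0
      have h2 : 0 < (((m + 1 : ℕ) : ℝ) ^ 5)⁻¹ * Real.exp (kappa163 4 / 4) := by positivity
      nlinarith [h1, h2, Real.exp_pos (kappa163 4 / 4)]
    positivity
  have h := abs_colH_G₀_road_le m hr μ y κ u
  refine h.trans (mul_le_of_le_one_right hC (Real.exp_le_one_iff.2 ?_))
  have := kappa163_pos 4
  have : 0 ≤ kappa163 4 / 4 / (4 * ((m + 1 : ℕ) : ℝ)) * l1 (u - ((m + 1 : ℕ) : ℤ) • y) := mul_nonneg (by positivity) (l1_nonneg _)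
  linarith

/-- **ROW (dd) AT THE HEAD's OWN PIN, UNSPLIT — NET `n¹` DISPLAYED** [our objects + folklore]: with the ROAD leg `G₀ = coDressKBmAt ρ_c n K₀` (sign-symmetric:
`BubbleParity.trK_coDressKBmAt_KInvStep`; dressed columns `≤ (n⁴)⁻¹·C_G′` in sup, F-g23-1's face-sheet power), for every `(a, e)`:
`Decay510 (z₀ ↦ ½·tadpole G₀ ([Λc e z₀, [Λc a 0, Dsh n]])) (32·n·C_G′·(Cλe^{κ′∕2})²·(e^{2κ′}+1)²·Zl 4 (κ′∕8)) (κ′∕8)`, `C_G′ = C₄·(1 + 8(1 + e^{κ₁₆₃(4)∕4}))·e^{κ₁₆₃(4)∕4}` — THE HEAD's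
row (dd) `hWdd`∕`hDdd` with a CLOSED constant carrying EXACTLY ONE power of `n` (O-8's sup count was `≍ n⁸`).  The remaining power is the dressed column's sheet power against the
UNSPLIT `Dsh` mass; the face split (O-6′ `DshFaceMass` × an interior∕face column envelope) is the located way to O(1) — NOT claimed here. -/
theorem decay510_row_dd_mass_road (a e : Fin 4) :
    Decay510 (fun z₀ : Site 4 => (1 / 2 : ℝ) * tadpole (coDressKBmAt (ctr 4 n) n (KInvStep (d := 3) n 0))
        (comp (diagK fun z' b => (n : ℝ) ^ 4 / 2 * bmGaugeAt (ctr 4 n) (colH (KInvStep (d := 3) n 0) n e z₀) n (legSite (ctr 4 n) z' b))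
            (comp (diagK fun z' b => (n : ℝ) ^ 4 / 2 * bmGaugeAt (ctr 4 n) (colH (KInvStep (d := 3) n 0) n a 0) n (legSite (ctr 4 n) z' b)) (Dsh n)
              - comp (Dsh n) (diagK fun z' b => (n : ℝ) ^ 4 / 2 * bmGaugeAt (ctr 4 n) (colH (KInvStep (d := 3) n 0) n a 0) n (legSite (ctr 4 n) z' b)))
          - comp (comp (diagK fun z' b => (n : ℝ) ^ 4 / 2 * bmGaugeAt (ctr 4 n) (colH (KInvStep (d := 3) n 0) n a 0) n (legSite (ctr 4 n) z' b)) (Dsh n)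
              - comp (Dsh n) (diagK fun z' b => (n : ℝ) ^ 4 / 2 * bmGaugeAt (ctr 4 n) (colH (KInvStep (d := 3) n 0) n a 0) n (legSite (ctr 4 n) z' b)))
            (diagK fun z' b => (n : ℝ) ^ 4 / 2 * bmGaugeAt (ctr 4 n) (colH (KInvStep (d := 3) n 0) n e z₀) n (legSite (ctr 4 n) z' b))))
      (32 * (n : ℝ) * ((MG163 4 * periodConst (kappa163 4) 3) * (1 + 8 * (1 + Real.exp (kappa163 4 / 4))) * Real.exp (kappa163 4 / 4))
        * ((((4 * (MG163 (3 + 1) * periodConst (kappa163 (3 + 1)) 3) * Real.exp (kappa163 (3 + 1) / ((3 : ℝ) + 1))) * Real.exp (kappa163 (3 + 1) / ((3 : ℝ) + 1) / 2)) * ((4 * (MG163 (3 + 1) * periodConst (kappa163 (3 + 1)) 3) * Real.exp (kappa163 (3 + 1) / ((3 : ℝ) + 1))) * Real.exp (kappa163 (3 + 1) / ((3 : ℝ) + 1) / 2))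
          * (Real.exp (2 * (kappa163 (3 + 1) / ((3 : ℝ) + 1))) + 1) ^ 2) * Zl 4 (kappa163 (3 + 1) / ((3 : ℝ) + 1) / 8)))
      (kappa163 (3 + 1) / ((3 : ℝ) + 1) / 8) := by
  have hn0 : (n : ℝ) ≠ 0 := by exact_mod_cast NeZero.ne n
  have hC : 0 ≤ (((n : ℝ) ^ 4)⁻¹ * ((MG163 4 * periodConst (kappa163 4) 3) * (1 + 8 * (1 + Real.exp (kappa163 4 / 4))) * Real.exp (kappa163 4 / 4))) := (abs_nonneg _).trans (abs_colH_G₀_le_const (n := n) 0 0 0 0)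
  have hcol : ∀ (μ : Fin (3 + 1)) (Y : Site (3 + 1)) (κ : Fin (3 + 1)) (u : Site (3 + 1)),
      |colH (coDressKBmAt (ctr 4 n) n (KInvStep (d := 3) n 0)) n μ Y κ u| ≤ (((n : ℝ) ^ 4)⁻¹ * ((MG163 4 * periodConst (kappa163 4) 3) * (1 + 8 * (1 + Real.exp (kappa163 4 / 4))) * Real.exp (kappa163 4 / 4))) :=
    fun μ Y κ u => abs_colH_G₀_le_const (n := n) μ Y κ u
  have hsym : trK (coDressKBmAt (ctr 4 n) n (KInvStep (d := 3) n 0)) = sgnK (coDressKBmAt (ctr 4 n) n (KInvStep (d := 3) n 0)) :=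
    trK_coDressKBmAt_KInvStep (d := 3) (ctrOff_mem_box (d := 3 + 1) (Nat.one_le_iff_ne_zero.2 (NeZero.ne n))) 0
  have h := decay510_row_dd_mass (n := n) hC (fun x Y α m => hcol m Y α x) (abs_inr_inl_le_of_sgn (n := n) hsym hcol) a e
  refine decay510_mono_const h (le_of_eq ?_)
  field_simp
  ring

/-- **ROW (dd) AT THE HEAD's OWN PIN IN ITS BINDER SHAPES — HYPOTHESIS-FREE, NET `n¹` DISPLAYED** [our objects + folklore] (`ChartDefectHead`'s `hAdd` ∕ `hBdd` for `Wdd` pinned by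
`hWdd`, via lit `absMoment₂_of_decay510` ∕ `secondMoment_abs_le_of_decay510` over `decay510_row_dd_mass_road`): (i) `∀ a e, AbsMoment₂ (z₀ ↦ ½·tadpole G₀ ([Λc e z₀, [Λc a 0, Dsh n]]))`;
(ii) `|secondMoment (a e z₀ ↦ …) μ ν| ≤ (32·n·C_G′·(Cλe^{κ′∕2})²·(e^{2κ′}+1)²·Zl 4 (κ′∕8))·Σ'_x |x|₁² e^{−(κ′∕8)|x|₁}` — usable as they stand at fixed `n` (`ChartDefectHead`); NOT m-uniform
(`ChartDefectHeadScales` binds the constant before `m`): the ONE power of `n` is displayed, not argued away. -/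
theorem row_dd_mass_road (μ ν : Fin 4) :
    (∀ a e : Fin 4, AbsMoment₂ (fun z₀ : Site 4 => (1 / 2 : ℝ) * tadpole (coDressKBmAt (ctr 4 n) n (KInvStep (d := 3) n 0))
        (comp (diagK fun z' b => (n : ℝ) ^ 4 / 2 * bmGaugeAt (ctr 4 n) (colH (KInvStep (d := 3) n 0) n e z₀) n (legSite (ctr 4 n) z' b))
            (comp (diagK fun z' b => (n : ℝ) ^ 4 / 2 * bmGaugeAt (ctr 4 n) (colH (KInvStep (d := 3) n 0) n a 0) n (legSite (ctr 4 n) z' b)) (Dsh n)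
              - comp (Dsh n) (diagK fun z' b => (n : ℝ) ^ 4 / 2 * bmGaugeAt (ctr 4 n) (colH (KInvStep (d := 3) n 0) n a 0) n (legSite (ctr 4 n) z' b)))
          - comp (comp (diagK fun z' b => (n : ℝ) ^ 4 / 2 * bmGaugeAt (ctr 4 n) (colH (KInvStep (d := 3) n 0) n a 0) n (legSite (ctr 4 n) z' b)) (Dsh n)
              - comp (Dsh n) (diagK fun z' b => (n : ℝ) ^ 4 / 2 * bmGaugeAt (ctr 4 n) (colH (KInvStep (d := 3) n 0) n a 0) n (legSite (ctr 4 n) z' b)))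
            (diagK fun z' b => (n : ℝ) ^ 4 / 2 * bmGaugeAt (ctr 4 n) (colH (KInvStep (d := 3) n 0) n e z₀) n (legSite (ctr 4 n) z' b))))) ∧
      |B12Beta.secondMoment (fun (a e : Fin 4) (z₀ : Site 4) => (1 / 2 : ℝ) * tadpole (coDressKBmAt (ctr 4 n) n (KInvStep (d := 3) n 0))
        (comp (diagK fun z' b => (n : ℝ) ^ 4 / 2 * bmGaugeAt (ctr 4 n) (colH (KInvStep (d := 3) n 0) n e z₀) n (legSite (ctr 4 n) z' b))
            (comp (diagK fun z' b => (n : ℝ) ^ 4 / 2 * bmGaugeAt (ctr 4 n) (colH (KInvStep (d := 3) n 0) n a 0) n (legSite (ctr 4 n) z' b)) (Dsh n)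
              - comp (Dsh n) (diagK fun z' b => (n : ℝ) ^ 4 / 2 * bmGaugeAt (ctr 4 n) (colH (KInvStep (d := 3) n 0) n a 0) n (legSite (ctr 4 n) z' b)))
          - comp (comp (diagK fun z' b => (n : ℝ) ^ 4 / 2 * bmGaugeAt (ctr 4 n) (colH (KInvStep (d := 3) n 0) n a 0) n (legSite (ctr 4 n) z' b)) (Dsh n)
              - comp (Dsh n) (diagK fun z' b => (n : ℝ) ^ 4 / 2 * bmGaugeAt (ctr 4 n) (colH (KInvStep (d := 3) n 0) n a 0) n (legSite (ctr 4 n) z' b)))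
            (diagK fun z' b => (n : ℝ) ^ 4 / 2 * bmGaugeAt (ctr 4 n) (colH (KInvStep (d := 3) n 0) n e z₀) n (legSite (ctr 4 n) z' b)))) μ ν|
        ≤ (32 * (n : ℝ) * ((MG163 4 * periodConst (kappa163 4) 3) * (1 + 8 * (1 + Real.exp (kappa163 4 / 4))) * Real.exp (kappa163 4 / 4))
            * ((((4 * (MG163 (3 + 1) * periodConst (kappa163 (3 + 1)) 3) * Real.exp (kappa163 (3 + 1) / ((3 : ℝ) + 1))) * Real.exp (kappa163 (3 + 1) / ((3 : ℝ) + 1) / 2)) * ((4 * (MG163 (3 + 1) * periodConst (kappa163 (3 + 1)) 3) * Real.exp (kappa163 (3 + 1) / ((3 : ℝ) + 1))) * Real.exp (kappa163 (3 + 1) / ((3 : ℝ) + 1) / 2))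
          * (Real.exp (2 * (kappa163 (3 + 1) / ((3 : ℝ) + 1))) + 1) ^ 2) * Zl 4 (kappa163 (3 + 1) / ((3 : ℝ) + 1) / 8)))
          * ∑' x : Site 4, l1 x ^ 2 * Real.exp (-(kappa163 (3 + 1) / ((3 : ℝ) + 1) / 8) * l1 x) := by
  have hr : 0 < kappa163 (3 + 1) / ((3 : ℝ) + 1) / 8 := by have := kappa163_pos (3 + 1); positivity
  have hd := fun a e => decay510_row_dd_mass_road (n := n) a e
  refine ⟨fun a e => absMoment₂_of_decay510 hr (hd a e), ?_⟩
  exact (secondMoment_abs_le_of_decay510 (P := fun (a e : Fin 4) (z₀ : Site 4) => (1 / 2 : ℝ) * tadpole (coDressKBmAt (ctr 4 n) n (KInvStep (d := 3) n 0))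
        (comp (diagK fun z' b => (n : ℝ) ^ 4 / 2 * bmGaugeAt (ctr 4 n) (colH (KInvStep (d := 3) n 0) n e z₀) n (legSite (ctr 4 n) z' b))
            (comp (diagK fun z' b => (n : ℝ) ^ 4 / 2 * bmGaugeAt (ctr 4 n) (colH (KInvStep (d := 3) n 0) n a 0) n (legSite (ctr 4 n) z' b)) (Dsh n)
              - comp (Dsh n) (diagK fun z' b => (n : ℝ) ^ 4 / 2 * bmGaugeAt (ctr 4 n) (colH (KInvStep (d := 3) n 0) n a 0) n (legSite (ctr 4 n) z' b)))
          - comp (comp (diagK fun z' b => (n : ℝ) ^ 4 / 2 * bmGaugeAt (ctr 4 n) (colH (KInvStep (d := 3) n 0) n a 0) n (legSite (ctr 4 n) z' b)) (Dsh n)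
              - comp (Dsh n) (diagK fun z' b => (n : ℝ) ^ 4 / 2 * bmGaugeAt (ctr 4 n) (colH (KInvStep (d := 3) n 0) n a 0) n (legSite (ctr 4 n) z' b)))
            (diagK fun z' b => (n : ℝ) ^ 4 / 2 * bmGaugeAt (ctr 4 n) (colH (KInvStep (d := 3) n 0) n e z₀) n (legSite (ctr 4 n) z' b)))) hr (hd μ ν)).2

end Road

end Summit.QuantumFields.BalabanUV.Beta.D1BFx.ChartDefectRowsDshMass

end
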